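import Summits.RiemannHypothesis.RiemannHypothesis.Theorems.TiltedLandingLaw421R3RateGlue2A

/-!
# RUNG-P v2 (lens-2 g6, O6-b (CA632)(B)) — the μ-explicit light/heavy split of C′'s perturbative rung (HELD; 0 sorry)
DECLDIFF vs `RungP-v1.lean` 869108403a6209b5: §0–§2 BYTE-VERBATIM (objects + C′, `BetaLevel`, `RungP`, window split, `SecondOrderNewtonDoorQ` = K-1,
CLOSED BY NAME by the tree-bound `RhW08.NewtonDoor.located_newton_door_lip`, GO-33-26); §3 of v1 REPLACED: `rho0`, `LipschitzBudgetQ C₀` (DEAD AS TYPED,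
CUT 27 (2): the second-order constant IS the local Lipschitz mass μ, unbounded), `ChildEnergyTwoQ C₀` (radius tied to the dead `rho0`) and the glue target
`DropFromDoorQ` (WITHDRAWN: costume arrow) are REMOVED; `PerturbativeDropQ`, `rungP_of_drop` KEPT verbatim.  NEW §3: the light/heavy split WITHOUT a zero
sum — a level is LIGHT at `w ∈ {v, z}` with witness `M` iff the cofactor `h := dslope f⁽ʲ⁾ w` is zero-free on the closed ball of radius `3/‖K_w‖` about `w`
(`K_w = h′(w)/h(w) = newtonK f j w`) and the natural-unit field derivative `Im w²·‖(h′/h)′‖ ≤ M` there (crit-1's μ_w is its centre value);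
★ `doorData_of_lightWitness` (PROVED, frame-free, mean-value inequality): a light witness `M` with `C₀ ≥ 9/2` and `C₀(1+M) ≤ λ_K²/2` DELIVERS K-1's
analytic door data with the μ-explicit radius `ρ₀ = C₀(1+M)/λ_K²` and `Λ = ρ₀‖K‖/(2(1+ρ₀))` — this is `LipschitzBudgetMuQ` as a THEOREM, not a law;
`ChildEnergyTwoLeQ` (W1-type, radius-free, an INEQUALITY); `PerturbativeDropLightQ C μ₀` (K-2's target: X ≥ 3 − C(1+μ₀)/λ on LIGHT β-levels);
`NearMassMonotoneQ μ₀` (the NEW LEMMA named by (CA632)(B): HEAVY β-levels have X ≥ 5/2 outright — «near mass raises X»; UNPROVED; cheapest falsifier in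
its docstring); ★ `rungP_of_light_heavy` (PROVED): `C(1+μ₀) ≤ 15` + light drop + heavy monotonicity ⟹ RUNG-P.  No implication-Props.  Nothing here bears
on the truth of RH; RH is not proved; RUNG-P is a CANDIDATE; C′ typed not proved; ★A / 33346 / 33347 OPEN; checked ≠ landed ≠ proved. -/

namespace RhW08.PerturbativeRung

open Complex RhW08.Round1 RhW08.StSwap RhW08.Round2 RhW08.QuadW RhW08.SealSwapQ RhW08.RateSplit RhW08.BurgersRate RhW08.BurgersRateG3
open RhW08.SealSwap (PBot)
open RhW08.AntiEscapeSplit7 RhIdea6.G17.W07C7 RhIdea6.G17.W07C7.Rev6 RhIdea6.G18.W07C8.Law421BirthS RhIdea6.G19.W07C11.Seam RhIdea6.G20.W07C12.Frac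
open RhIdea6.G20.W07C12.StColP RhW07.C12.FieldSplit RhIdea6.G21.W07C13.TentMax RhW07.C14.TwoSided RhW07.C14.Classes RhW07.C14.Lineage RhW07.C14.Booking

/-! ## §0 Objects and C′ (verbatim bodies from `TouchedDissipation-v3opt.lean` §1–§2) -/
/-- §0 (verbatim) the TOUCH relation. -/
def Touches (f : ℂ → ℂ) (j : ℕ) (v z : ℂ) : Prop :=
  iteratedDeriv j f z = 0 ∧ v.im < z.im ∧ |v.re - z.re| ≤ v.im + z.im

/-- §0 (verbatim) the ATOMIC pair. -/
def AtomicPair (f : ℂ → ℂ) (j : ℕ) (v z : ℂ) : Prop :=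
  ∀ u : ℂ, iteratedDeriv j f u = 0 → 0 < u.im → u ≠ v → u ≠ z → v.im + u.im < |v.re - u.re| ∧ z.im + u.im < |z.re - u.re|

/-- §0 (verbatim) `Ū = D̄_v ∪ D̄_z`. -/
def pairUnion (v z : ℂ) : Set ℂ :=
  {u : ℂ | ‖u - (v.re : ℂ)‖ ≤ v.im ∨ ‖u - (z.re : ℂ)‖ ≤ z.im}

/-- §0 (verbatim) the multiplicity-weighted energy of the upper children off `Z(f⁽ʲ⁾)` in `S`. -/
noncomputable def childEnergy (f : ℂ → ℂ) (j : ℕ) (S : Set ℂ) : ℝ :=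
  ∑ᶠ u ∈ {u : ℂ | (iteratedDeriv (j + 1) f u = 0 ∧ iteratedDeriv j f u ≠ 0 ∧ u ∈ S) ∧ 0 < u.im},
    (analyticOrderNatAt (iteratedDeriv (j + 1) f) u : ℝ) * u.im ^ 2

/-- §0 (verbatim) `κ_v := ‖tiltAt f j v‖`. -/
noncomputable def stateKappa (f : ℂ → ℂ) (j : ℕ) (v : ℂ) : ℝ := ‖tiltAt f j v‖

/-- §0 (verbatim) C′ = `TouchedDissipationLawQ c κ₀`. -/
def TouchedDissipationLawQ (c κ₀ : ℝ) : Prop :=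
  ∀ (η : ℝ) (f : ℂ → ℂ) (x₀ s hmax R Hs : ℝ) (B : ℕ), EngineHyps5 2 η f x₀ s hmax R Hs B →
    ∀ (j : ℕ) (v z : ℂ), Charged (PTrkSQ PBot) StTrkDQ ReadyR2 η f x₀ s hmax R Hs B j → ApproachLevelQ η f x₀ s hmax R Hs B j →
      IsLowest StTrkDQ η f x₀ s hmax R Hs B j v → Touches f j v z → AtomicPair f j v z →
      κ₀ ≤ v.im * stateKappa f j v →
      c ≤ ((v.im ^ 2 + z.im ^ 2) - childEnergy f j (pairUnion v z)) * stateKappa f j v ^ 2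

/-- C′'s five LEVEL BINDERS bundled (charged approach level `j`, lowest state `v` touched by `z`, the pair atomic) — used by the NEW Props only. -/
def BetaLevel (η : ℝ) (f : ℂ → ℂ) (x₀ s hmax R Hs : ℝ) (B j : ℕ) (v z : ℂ) : Prop :=
  Charged (PTrkSQ PBot) StTrkDQ ReadyR2 η f x₀ s hmax R Hs B j ∧ ApproachLevelQ η f x₀ s hmax R Hs B j ∧
    IsLowest StTrkDQ η f x₀ s hmax R Hs B j v ∧ Touches f j v z ∧ AtomicPair f j v z

/-! ## §1 RUNG-P and the window split -/

/-- (i) ★ RUNG-P(30) := C′ with `c₁ = 5/2` above the floor `Λ₀ = 30` — the perturbative rung (theorem CANDIDATE). -/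
def RungP : Prop := TouchedDissipationLawQ (5 / 2) 30

/-- (ii) the WINDOW variant of C′: the same population restricted to `κ₀ ≤ λ < κ₁` (`λ = Im v·κ_v`). -/
def TouchedDissipationLawQ₂ (c κ₀ κ₁ : ℝ) : Prop :=
  ∀ (η : ℝ) (f : ℂ → ℂ) (x₀ s hmax R Hs : ℝ) (B : ℕ), EngineHyps5 2 η f x₀ s hmax R Hs B → ∀ (j : ℕ) (v z : ℂ), BetaLevel η f x₀ s hmax R Hs B j v z →
      κ₀ ≤ v.im * stateKappa f j v → v.im * stateKappa f j v < κ₁ →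
      c ≤ ((v.im ^ 2 + z.im ^ 2) - childEnergy f j (pairUnion v z)) * stateKappa f j v ^ 2

/-- ★ (ii) THE SPLIT IS LITERALLY TRUE: RUNG-P (`λ ≥ 30`) and the window law C′(3/2) on `3 ≤ λ < 30` give C′(3/2, 3) (case on `λ < 30`). -/
theorem lawQ_of_rungP_of_window (hP : RungP) (hW : TouchedDissipationLawQ₂ (3 / 2) 3 30) : TouchedDissipationLawQ (3 / 2) 3 := by
  intro η f x₀ s hmax R Hs B hE j v z hch hA hlow ht ha hfl
  by_cases hlt : v.im * stateKappa f j v < 30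
  · exact hW η f x₀ s hmax R Hs B hE j v z ⟨hch, hA, hlow, ht, ha⟩ hfl hlt
  · have h := hP η f x₀ s hmax R Hs B hE j v z hch hA hlow ht ha (not_lt.1 hlt)
    linarith

/-! ## §2 The second-order (located) Newton door — K-1 -/

/-- (iii) ★ the LOCATED NEWTON DOOR (classical Rouché vs the linear model, Lipschitz form; hypotheses = the tree's `succ_of_newton_door` ∘
`fieldVariation_of_lipschitz`): `F = (· − v)·h`, `K ≠ 0`, `0 < ρ₀`, `h ≠ 0` on the closed Newton disc `‖u − (v − K⁻¹)‖ ≤ ρ₀/‖K‖`, field `Λ`-close to `K`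
on the Newton circle with `(1+ρ₀)Λ < ρ₀‖K‖` ⇒ a zero `u` of `F′` with `h u ≠ 0` (a MOVING child) INSIDE the disc.  Second order: `ρ₀ = C₀/λ²`.  K-1 target. -/
def SecondOrderNewtonDoorQ : Prop :=
  ∀ (F h : ℂ → ℂ) (v K : ℂ) (ρ₀ Λ : ℝ), Differentiable ℂ F → Differentiable ℂ h → (∀ u : ℂ, F u = (u - v) * h u) → K ≠ 0 → 0 < ρ₀ →
    (1 + ρ₀) * Λ < ρ₀ * ‖K‖ →
    (∀ u : ℂ, ‖u - (v - K⁻¹)‖ ≤ ρ₀ / ‖K‖ → h u ≠ 0) →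
    (∀ u : ℂ, ‖u - (v - K⁻¹)‖ = ρ₀ / ‖K‖ → ‖deriv h u / h u - K‖ ≤ Λ) →
    ∃ u : ℂ, ‖u - (v - K⁻¹)‖ < ρ₀ / ‖K‖ ∧ deriv F u = 0 ∧ h u ≠ 0

/-! ## §3 (v2) The light/heavy split, μ-explicit and zero-sum-free -/

/-- (K, verbatim v1) the perturbative dissipation estimate «X ≥ 3 − C/λ» on β-levels above the floor 3 (unsplit form). -/
def PerturbativeDropQ (C : ℝ) : Prop :=
  ∀ (η : ℝ) (f : ℂ → ℂ) (x₀ s hmax R Hs : ℝ) (B : ℕ), EngineHyps5 2 η f x₀ s hmax R Hs B → ∀ (j : ℕ) (v z : ℂ), BetaLevel η f x₀ s hmax R Hs B j v z → 3 ≤ v.im * stateKappa f j v →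
      3 - C / (v.im * stateKappa f j v) ≤ ((v.im ^ 2 + z.im ^ 2) - childEnergy f j (pairUnion v z)) * stateKappa f j v ^ 2

/-- ★ (K, verbatim v1) RUNG-P FROM THE DROP: any `C ≤ 15` gives `3 − C/λ ≥ 5/2` on `λ ≥ 30`. -/
theorem rungP_of_drop {C : ℝ} (hC : C ≤ 15) (hD : PerturbativeDropQ C) : RungP := by
  intro η f x₀ s hmax R Hs B hE j v z hch hA hlow ht ha hfl
  have h := hD η f x₀ s hmax R Hs B hE j v z ⟨hch, hA, hlow, ht, ha⟩ (by linarith)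
  have hl : (0 : ℝ) < v.im * stateKappa f j v := by linarith
  have hq : C / (v.im * stateKappa f j v) ≤ 1 / 2 := by
    rw [div_le_iff₀ hl]; linarith
  linarith

/-- the cofactor FIELD VALUE `K_w := h′(w)/h(w)`; for `h = dslope (iteratedDeriv j f) w` this is `newtonK f j w` (`fieldK_dslope`, `rfl`). -/
noncomputable def fieldK (h : ℂ → ℂ) (w : ℂ) : ℂ := deriv h w / h w

/-- `fieldK (dslope f⁽ʲ⁾ w) w = newtonK f j w`, definitionally. -/
theorem fieldK_dslope (f : ℂ → ℂ) (j : ℕ) (w : ℂ) : fieldK (dslope (iteratedDeriv j f) w) w = newtonK f j w := rfl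

/-- (v2) a LIGHT WITNESS `M` at `w` for the cofactor `h`: `K_w ≠ 0`, `0 ≤ M`, and on the CLOSED ball of radius `3/‖K_w‖` about `w` the cofactor is
zero-free and the natural-unit field derivative is bounded, `Im w²·‖(h′/h)′(u)‖ ≤ M` (crit-1's local Lipschitz mass μ_w = the value at `u = w`). -/
def LightWitness (h : ℂ → ℂ) (w : ℂ) (M : ℝ) : Prop :=
  fieldK h w ≠ 0 ∧ 0 ≤ M ∧
    ∀ u : ℂ, ‖u - w‖ ≤ 3 / ‖fieldK h w‖ → h u ≠ 0 ∧ w.im ^ 2 * ‖deriv (fun t => deriv h t / h t) u‖ ≤ M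

/-- (v2) the μ-explicit second-order Newton radius parameter `ρ₀ := C₀·(1 + M)/λ_K²`, `λ_K = Im w·‖K_w‖`. -/
noncomputable def rhoMu (C₀ M : ℝ) (h : ℂ → ℂ) (w : ℂ) : ℝ := C₀ * (1 + M) / (w.im * ‖fieldK h w‖) ^ 2

/-- ★ (v2, PROVED — this is `LipschitzBudgetMuQ` as a THEOREM) DOOR DATA FROM A LIGHT WITNESS: `h` entire, `0 < Im w`, a light witness `M`, `9/2 ≤ C₀` and
the smallness `C₀(1+M) ≤ λ_K²/2` give, with `ρ₀ = rhoMu C₀ M h w` and `Λ = ρ₀‖K‖/(2(1+ρ₀))`: `0 < ρ₀ ≤ 1/2`, the scalar door condition `(1+ρ₀)Λ < ρ₀‖K‖`,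
`h` zero-free on the closed Newton disc `‖u − (w − K⁻¹)‖ ≤ ρ₀/‖K‖`, and the closeness `‖h′/h(u) − K‖ ≤ Λ` on the Newton circle (mean-value inequality on
the convex ball `‖u − w‖ ≤ (1+ρ₀)/‖K‖ ⊆` the witness ball).  These are exactly the analytic hypotheses of K-1 (`SecondOrderNewtonDoorQ` /
`RhW08.NewtonDoor.located_newton_door_lip`) at `(F, h, w, K_w, ρ₀, Λ)`. -/
theorem doorData_of_lightWitness {h : ℂ → ℂ} {w : ℂ} {M C₀ : ℝ} (hh : Differentiable ℂ h) (hw : 0 < w.im)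
    (hW : LightWitness h w M) (hC₀ : 9 / 2 ≤ C₀) (hsmall : C₀ * (1 + M) ≤ (w.im * ‖fieldK h w‖) ^ 2 / 2) :
    0 < rhoMu C₀ M h w ∧ rhoMu C₀ M h w ≤ 1 / 2 ∧
      (1 + rhoMu C₀ M h w) * (rhoMu C₀ M h w * ‖fieldK h w‖ / (2 * (1 + rhoMu C₀ M h w))) < rhoMu C₀ M h w * ‖fieldK h w‖ ∧
      (∀ u : ℂ, ‖u - (w - (fieldK h w)⁻¹)‖ ≤ rhoMu C₀ M h w / ‖fieldK h w‖ → h u ≠ 0) ∧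
      (∀ u : ℂ, ‖u - (w - (fieldK h w)⁻¹)‖ = rhoMu C₀ M h w / ‖fieldK h w‖ →
        ‖deriv h u / h u - fieldK h w‖ ≤ rhoMu C₀ M h w * ‖fieldK h w‖ / (2 * (1 + rhoMu C₀ M h w))) := by
  obtain ⟨hK, hM0, hball⟩ := hW
  set K := fieldK h w with hKdef
  set ρ₀ := rhoMu C₀ M h w with hρdef
  have hKn : 0 < ‖K‖ := norm_pos_iff.mpr hK
  have hlam : 0 < w.im * ‖K‖ := mul_pos hw hKn
  have hC0 : 0 < C₀ := by linarith
  have hρ0 : 0 < ρ₀ := by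
    show 0 < C₀ * (1 + M) / (w.im * ‖K‖) ^ 2
    positivity
  have hρeq : ρ₀ * (w.im * ‖K‖) ^ 2 = C₀ * (1 + M) := by
    show C₀ * (1 + M) / (w.im * ‖K‖) ^ 2 * (w.im * ‖K‖) ^ 2 = C₀ * (1 + M)
    field_simp
  have hρhalf : ρ₀ ≤ 1 / 2 := by
    show C₀ * (1 + M) / (w.im * ‖K‖) ^ 2 ≤ 1 / 2
    rw [div_le_iff₀ (by positivity)]
    linarith
  -- the Newton disc sits inside the witness ball
  have hdisc : ∀ u : ℂ, ‖u - (w - K⁻¹)‖ ≤ ρ₀ / ‖K‖ → ‖u - w‖ ≤ (1 + ρ₀) / ‖K‖ := fun u hu =>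
    RhW08.NewtonDoor.norm_sub_le_of_newtonDisc hK hu
  have h3 : (1 + ρ₀) / ‖K‖ ≤ 3 / ‖K‖ := div_le_div_of_nonneg_right (by linarith) hKn.le
  refine ⟨hρ0, hρhalf, ?_, fun u hu => (hball u ((hdisc u hu).trans h3)).1, fun u hu => ?_⟩
  · -- `(1+ρ₀)·Λ = ρ₀‖K‖/2 < ρ₀‖K‖`
    have h1 : (1 + ρ₀) * (ρ₀ * ‖K‖ / (2 * (1 + ρ₀))) = ρ₀ * ‖K‖ / 2 := by
      field_simp
    rw [h1]
    have : 0 < ρ₀ * ‖K‖ := mul_pos hρ0 hKn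
    linarith
  · -- closeness on the Newton circle by the mean-value inequality on the ball `‖t − w‖ ≤ (1+ρ₀)/‖K‖`
    set r := (1 + ρ₀) / ‖K‖ with hrdef
    have hur : ‖u - w‖ ≤ r := hdisc u hu.le
    have hin : ∀ t ∈ Metric.closedBall w r, h t ≠ 0 ∧ w.im ^ 2 * ‖deriv (fun t => deriv h t / h t) t‖ ≤ M := by
      intro t ht
      have ht' : ‖t - w‖ ≤ r := by rwa [Metric.mem_closedBall, dist_eq_norm] at ht
      exact hball t (ht'.trans h3)
    have hdiff : ∀ t ∈ Metric.closedBall w r, DifferentiableAt ℂ (fun t => deriv h t / h t) t := by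
      intro t ht
      exact ((hh.analyticAt t).deriv.differentiableAt).div (hh t) (hin t ht).1
    have hbound : ∀ t ∈ Metric.closedBall w r, ‖deriv (fun t => deriv h t / h t) t‖ ≤ M / w.im ^ 2 := by
      intro t ht
      rw [le_div_iff₀ (pow_pos hw 2), mul_comm]
      exact (hin t ht).2
    have hwmem : w ∈ Metric.closedBall w r := Metric.mem_closedBall_self (by positivity)
    have humem : u ∈ Metric.closedBall w r := by
      rw [Metric.mem_closedBall, dist_eq_norm]; exact hur
    have hmvt := (convex_closedBall w r).norm_image_sub_le_of_norm_deriv_le hdiff hbound hwmem humem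
    -- `hmvt : ‖h′/h(u) − h′/h(w)‖ ≤ M/Im w² · ‖u − w‖`
    have hKw : deriv h w / h w = K := rfl
    have hstep : ‖deriv h u / h u - K‖ ≤ M / w.im ^ 2 * r := by
      have := hmvt
      simp only [hKw] at this
      exact this.trans (mul_le_mul_of_nonneg_left hur (by positivity))
    refine hstep.trans ?_
    -- `M/Im w² · (1+ρ₀)/‖K‖ ≤ ρ₀‖K‖/(2(1+ρ₀))` ⟸ `2(1+ρ₀)²·M ≤ ρ₀·λ_K² = C₀(1+M)`, `(1+ρ₀)² ≤ 9/4`, `9/2 ≤ C₀`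
    rw [hrdef, div_mul_div_comm, div_le_div_iff₀ (by positivity) (by positivity)]
    have hsq : (1 + ρ₀) ^ 2 ≤ 9 / 4 := by nlinarith
    have hkey : 2 * (1 + ρ₀) ^ 2 * M ≤ C₀ * (1 + M) := by nlinarith [mul_nonneg hM0 hC0.le]
    nlinarith [hρeq, hkey, mul_pos hw hKn, pow_pos hw 2, hKn]

/-- (v2) LIGHT at `w` within `μ₀` for the level-`j` cofactor: some light witness `M ≤ μ₀` of `dslope (iteratedDeriv j f) w` at `w`. -/
def LightAt (μ₀ : ℝ) (f : ℂ → ℂ) (j : ℕ) (w : ℂ) : Prop := ∃ M : ℝ, M ≤ μ₀ ∧ LightWitness (dslope (iteratedDeriv j f) w) w M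

/-- (v2, W1-type, radius-free, an INEQUALITY — replaces v1's `ChildEnergyTwoQ C₀`) on β-levels above the floor 30, two MOVING children located in the
two half-Newton discs (`‖u₁ − (v − K_v⁻¹)‖ ≤ 1/(2‖K_v‖)`, `‖u₂ − (z − K_z⁻¹)‖ ≤ 1/(2‖K_z‖)`, which contain every second-order Newton disc with
`ρ₀ ≤ 1/2`) MAJORISE the child energy of `Ū`.  All a LOWER bound on X needs.  COROLLARY ROUTE (tree #1174 `RhW08.ClusterCount.clusterCount_of_charged`):
the window `(α, β) := (min(Re v − Im v, Re z − Im z), max(Re v + Im v, Re z + Im z))` is CLEAR by `AtomicPair` (touching ⇒ no gap between the two discs;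
every other zero's disc is laterally outside `[α, β]`), the weighted upper-child count in it is `ncard {v, z} = 2`, the two located children lie in it
(`λ ≥ 30`), hence they are ALL its children, each simple, and the upper part of `Ū` lies in the window — four routine steps, not done here. -/
def ChildEnergyTwoLeQ : Prop :=
  ∀ (η : ℝ) (f : ℂ → ℂ) (x₀ s hmax R Hs : ℝ) (B : ℕ), EngineHyps5 2 η f x₀ s hmax R Hs B → ∀ (j : ℕ) (v z : ℂ), BetaLevel η f x₀ s hmax R Hs B j v z → 30 ≤ v.im * stateKappa f j v →
      ∀ u₁ u₂ : ℂ, u₁ ≠ u₂ → iteratedDeriv (j + 1) f u₁ = 0 → iteratedDeriv j f u₁ ≠ 0 → iteratedDeriv (j + 1) f u₂ = 0 → iteratedDeriv j f u₂ ≠ 0 →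
        ‖u₁ - (v - (newtonK f j v)⁻¹)‖ ≤ 1 / (2 * ‖newtonK f j v‖) → ‖u₂ - (z - (newtonK f j z)⁻¹)‖ ≤ 1 / (2 * ‖newtonK f j z‖) →
        childEnergy f j (pairUnion v z) ≤ u₁.im ^ 2 + u₂.im ^ 2

/-- (v2, K-2's TARGET LAW) the perturbative drop on LIGHT β-levels: `X ≥ 3 − C·(1 + μ₀)/λ` whenever both `v` and its toucher `z` are light within `μ₀`
(PROOF ROUTE = K-2, by name: K-1 `RhW08.NewtonDoor.located_newton_door_lip` (GO-33-26) fed with `doorData_of_lightWitness` (C₀ = 9/2, at `w = v` and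
`w = z`, `F = iteratedDeriv j f`, `h = dslope F w`); K-2a = C4 g38 image 56 `K2aNewtonDiscDrop-W08-C4-rh-idea-6-g38.lean` 38015dd835f7e30d, ns `RhW08.NewtonDiscDrop`:
`im_window_of_newton_disc`, `energy_drop_pair`, `drop_scaled_of_pair` with `δ_w = ρ₀(w)/‖K_w‖ ≤ (9/2)(1+μ₀)/(λ_w²‖K_w‖)`; `ChildEnergyTwoLeQ`; the
λ-bookkeeping `Im K_w = −1/(2 Im w) + pulls` (tree #1176 `RhW08.UncoveredSign`), `‖newtonK‖` vs `stateKappa` (`tiltAt = newtonK + I/(2 Im w)`), and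
`LeadingDissipation.leading_ge_three_of_touch` (main term ≥ 3); the error terms are `O((1+μ₀)/λ)` — the constant `C` is whatever they sum to). -/
def PerturbativeDropLightQ (C μ₀ : ℝ) : Prop :=
  ∀ (η : ℝ) (f : ℂ → ℂ) (x₀ s hmax R Hs : ℝ) (B : ℕ), EngineHyps5 2 η f x₀ s hmax R Hs B → ∀ (j : ℕ) (v z : ℂ), BetaLevel η f x₀ s hmax R Hs B j v z → 30 ≤ v.im * stateKappa f j v →
      LightAt μ₀ f j v → LightAt μ₀ f j z →
      3 - C * (1 + μ₀) / (v.im * stateKappa f j v) ≤ ((v.im ^ 2 + z.im ^ 2) - childEnergy f j (pairUnion v z)) * stateKappa f j v ^ 2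

/-- (v2, the NEW LEMMA of (CA632)(B), UNPROVED) NEAR MASS RAISES X: a β-level above the floor 30 that is HEAVY (no light witness within `μ₀` at `v` or at `z`:
a cofactor zero within `3/‖K_w‖` of `w`, or natural-unit field derivative `> μ₀` on that ball — i.e. mass at Newton scale) has `X ≥ 5/2` outright.
Evidence: crit-1 CUT 27 (1), 150 300 rows — near mass only RAISES X (3.13 → 4.03 → … → 89 as m = 0 → 140; min X(λ ≥ 30, m ≥ 5) = 4.01); near-coincident twins
merge two zeros into one child (ΔE ≈ Im v², X → ∞).  CHEAPEST FALSIFIER: minimise X over crit-1's atomic-edge near-zoo rows restricted to the heavy side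
`μ_w > μ₀` (μ_v ≈ 0.19·m) at the smallest qualifying m, both tilt signs; a heavy row with X < 5/2 kills it (class substantive). -/
def NearMassMonotoneQ (μ₀ : ℝ) : Prop :=
  ∀ (η : ℝ) (f : ℂ → ℂ) (x₀ s hmax R Hs : ℝ) (B : ℕ), EngineHyps5 2 η f x₀ s hmax R Hs B → ∀ (j : ℕ) (v z : ℂ), BetaLevel η f x₀ s hmax R Hs B j v z → 30 ≤ v.im * stateKappa f j v →
      ¬ (LightAt μ₀ f j v ∧ LightAt μ₀ f j z) →
      5 / 2 ≤ ((v.im ^ 2 + z.im ^ 2) - childEnergy f j (pairUnion v z)) * stateKappa f j v ^ 2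

/-- ★ (v2, PROVED) RUNG-P FROM THE SPLIT: `C·(1+μ₀) ≤ 15` (e.g. `C = 5`, `μ₀ = 2`), the light drop and the heavy monotonicity give RUNG-P (case on light/heavy;
on the light side `C(1+μ₀)/λ ≤ 15/30 = 1/2`). -/
theorem rungP_of_light_heavy {C μ₀ : ℝ} (hCμ : C * (1 + μ₀) ≤ 15)
    (hL : PerturbativeDropLightQ C μ₀) (hH : NearMassMonotoneQ μ₀) : RungP := by
  intro η f x₀ s hmax R Hs B hE j v z hch hA hlow ht ha hfl
  by_cases hlt : LightAt μ₀ f j v ∧ LightAt μ₀ f j z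
  · have h := hL η f x₀ s hmax R Hs B hE j v z ⟨hch, hA, hlow, ht, ha⟩ hfl hlt.1 hlt.2
    have hl : (0 : ℝ) < v.im * stateKappa f j v := by linarith
    have hq : C * (1 + μ₀) / (v.im * stateKappa f j v) ≤ 1 / 2 := by
      rw [div_le_iff₀ hl]; nlinarith
    linarith
  · exact hH η f x₀ s hmax R Hs B hE j v z ⟨hch, hA, hlow, ht, ha⟩ hfl hlt

end RhW08.PerturbativeRung
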